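import Literature.Topology.FourManifolds.ConnectedSum
import Mathlib.Analysis.Convex.Mul
import Mathlib.Analysis.Calculus.LocalExtr.Basic

/-!
# A counterexample: the named fact `Literature.Topology.FourManifolds.IsOpenGluing.of_diffeomorph` is false

`Literature.Topology.FourManifolds.IsOpenGluing.of_diffeomorph` (file `ConnectedSum`) asserts that an open gluing
`IsOpenGluing IA IB IP (P := P) R` is transported along any diffeomorphism `P ≃ₘ⟮IP, IP'⟯ P'` for
two *arbitrary* models with corners `IP : ModelWithCorners ℝ EP HP`,
`IP' : ModelWithCorners ℝ EP HP'` on the same vector space. This file proves that this statement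
is **false** (`Literature.Topology.FourManifolds.OpenGluingCounterexample.not_isOpenGluing_of_diffeomorph`), so that the fact
must not be discharged or instantiated; the corrected (and proved) statement is
`Literature.Topology.FourManifolds.IsOpenGluing.of_diffeomorph_of_range_eq` (hypothesis `range IP' = range IP`).

## The counterexample

* `EP = ℝ × ℝ`; `Parab = {(x, y) | x² ≤ y}` (closed, convex, nonempty interior) with the model
  `modelParab : ModelWithCorners ℝ (ℝ × ℝ) Parab` given by the inclusion (inverse: the vertical
  retraction `(x, y) ↦ (x, max y x²)`); `Half = {(x, y) | 0 ≤ y}` with the analogous model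
  `modelHalf`. Both are charted spaces over themselves, hence `C^∞` manifolds.
* `shearDiffeo : Parab ≃ₘ⟮modelParab, modelHalf⟯ Half`, `(x, y) ↦ (x, y - x²)` (polynomial both
  ways).
* `isOpenGluing_parab_eq`: `Parab` is the open gluing of `Parab` and `Parab` along `Eq` (both
  pieces embedded by `id`).
* `not_isOpenGluing_half`: `Half` is *not* such an open gluing. Indeed the two embeddings would
  coincide and be a surjective `C^∞` embedding `j : Parab → Half`, in particular a Mathlib
  immersion at the corner `(0, 0)`: there would be charts `φ` (of `Parab`, in the maximal atlas of
  `modelParab`) and `ψ` (of `Half`) and a linear equivalence `L` with `ψ ∘ j ∘ φ⁻¹ = L ∘ (·, 0)`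
  on the target `V ⊆ Parab` of `φ`. Then (Step 1) `u ↦ L (u, 0)` is a linear automorphism of
  `ℝ²` (its range contains an open piece of the half-plane, `j` being open); (Step 2) `φ (0, 0)`
  lies on the parabola `y = x²` (else `φ⁻¹` would be differentiable near `φ (0,0)` with values in
  `y ≥ x² ≥ 0` and value `(0, 0)`, forcing a singular derivative, contradicting the chart being a
  within-differentiable left inverse); (Step 3) parabola points near `φ (0, 0)` are boundary
  points of `V`, mapped by the linear automorphism to boundary points of the half-plane, i.e.
  into the line `y = 0` — a parabola arc cannot be mapped into a line by a linear automorphism.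

The root cause: Mathlib's `IsImmersionAt` asks for charts in which the map is *linear*, so the
germs of `range IA` and `range IP'` must be linearly equivalent, whereas a `Diffeomorph` between
manifolds with different models only identifies `range IP` and `range IP'` by a homeomorphism
that is smooth *within* these (convex) sets. Everything here is elementary real analysis; no
source is cited (the construction is ours), all declarations are tagged folklore.
-/

open scoped Manifold ContDiff Topology
open Set Function

noncomputable section

namespace Literature.Topology.FourManifolds

namespace OpenGluingCounterexample

/-- The closed convex region `C = {(x, y) | x² ≤ y}` above the standard parabola. [folklore] -/
def parabolaRegion : Set (ℝ × ℝ) := {p | p.1 ^ 2 ≤ p.2}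

/-- The closed upper half-plane `{(x, y) | 0 ≤ y}`. [folklore] -/
def upperHalfPlane : Set (ℝ × ℝ) := {p | 0 ≤ p.2}

/-- The region above the parabola, as a type. [folklore] -/
abbrev Parab : Type := parabolaRegion

/-- The closed upper half-plane, as a type. [folklore] -/
abbrev Half : Type := upperHalfPlane

/-- Auxiliary (convex parabolaRegion), see the module docstring. [folklore] -/
theorem convex_parabolaRegion : Convex ℝ parabolaRegion := by
  have h : ConvexOn ℝ univ fun x : ℝ => x ^ 2 := Even.convexOn_pow even_two
  have := h.convex_epigraph
  convert this using 1
  ext p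
  simp [parabolaRegion]

/-- Auxiliary (convex upperHalfPlane), see the module docstring. [folklore] -/
theorem convex_upperHalfPlane : Convex ℝ upperHalfPlane := by
  have : Convex ℝ {p : ℝ × ℝ | 0 ≤ (ContinuousLinearMap.snd ℝ ℝ ℝ) p} :=
    convex_halfSpace_ge (ContinuousLinearMap.snd ℝ ℝ ℝ).isLinear 0
  simpa [upperHalfPlane] using this

/-- Auxiliary (isOpen strictParabolaRegion), see the module docstring. [folklore] -/
theorem isOpen_strictParabolaRegion : IsOpen {p : ℝ × ℝ | p.1 ^ 2 < p.2} :=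
  isOpen_lt (by fun_prop) (by fun_prop)

/-- Auxiliary (isOpen strictUpperHalfPlane), see the module docstring. [folklore] -/
theorem isOpen_strictUpperHalfPlane : IsOpen {p : ℝ × ℝ | 0 < p.2} :=
  isOpen_lt (by fun_prop) (by fun_prop)

/-- The model with corners `Parab → ℝ²` (inclusion), with inverse the vertical retraction
`(x, y) ↦ (x, max y x²)`. [folklore] -/
def modelParab : ModelWithCorners ℝ (ℝ × ℝ) Parab :=
  ModelWithCorners.ofConvexRange
    { toFun := Subtype.val
      invFun := fun p => ⟨(p.1, max p.2 (p.1 ^ 2)), by simp [parabolaRegion]⟩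
      source := univ
      target := parabolaRegion
      map_source' := fun x _ => x.2
      map_target' := fun _ _ => mem_univ _
      left_inv' := by
        rintro ⟨⟨x, y⟩, hxy⟩ -
        have : x ^ 2 ≤ y := hxy
        ext <;> simp [max_eq_left this]
      right_inv' := by
        rintro ⟨x, y⟩ hxy
        have : x ^ 2 ≤ y := hxy
        ext <;> simp [max_eq_left this] }
    rfl convex_parabolaRegion continuous_subtype_val
    (show Continuous (fun p : ℝ × ℝ => (⟨(p.1, max p.2 (p.1 ^ 2)), by simp [parabolaRegion]⟩ :
      Parab)) by fun_prop)
    ⟨(0, 1), by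
      have hsub : {p : ℝ × ℝ | p.1 ^ 2 < p.2} ⊆ parabolaRegion := fun p (hp : p.1 ^ 2 < p.2) =>
        show p.1 ^ 2 ≤ p.2 from le_of_lt hp
      apply interior_mono hsub
      rw [isOpen_strictParabolaRegion.interior_eq]
      norm_num⟩

/-- The model with corners `Half → ℝ²` (inclusion), with inverse `(x, y) ↦ (x, max y 0)`.
[folklore] -/
def modelHalf : ModelWithCorners ℝ (ℝ × ℝ) Half :=
  ModelWithCorners.ofConvexRange
    { toFun := Subtype.val
      invFun := fun p => ⟨(p.1, max p.2 0), by simp [upperHalfPlane]⟩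
      source := univ
      target := upperHalfPlane
      map_source' := fun x _ => x.2
      map_target' := fun _ _ => mem_univ _
      left_inv' := by
        rintro ⟨⟨x, y⟩, hxy⟩ -
        have : 0 ≤ y := hxy
        ext <;> simp [max_eq_left this]
      right_inv' := by
        rintro ⟨x, y⟩ hxy
        have : 0 ≤ y := hxy
        ext <;> simp [max_eq_left this] }
    rfl convex_upperHalfPlane continuous_subtype_val
    (show Continuous (fun p : ℝ × ℝ => (⟨(p.1, max p.2 0), by simp [upperHalfPlane]⟩ : Half)) by
      fun_prop)
    ⟨(0, 1), by
      have hsub : {p : ℝ × ℝ | 0 < p.2} ⊆ upperHalfPlane := fun p (hp : 0 < p.2) =>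
        show 0 ≤ p.2 from le_of_lt hp
      apply interior_mono hsub
      rw [isOpen_strictUpperHalfPlane.interior_eq]
      norm_num⟩

/-- Auxiliary (modelParab apply), see the module docstring. [folklore] -/
@[simp] theorem modelParab_apply (p : Parab) : modelParab p = p.1 := rfl
/-- Auxiliary (modelHalf apply), see the module docstring. [folklore] -/
@[simp] theorem modelHalf_apply (p : Half) : modelHalf p = p.1 := rfl
/-- Auxiliary (modelParab symm apply coe), see the module docstring. [folklore] -/
@[simp] theorem modelParab_symm_apply_coe (p : ℝ × ℝ) :
    ((modelParab.symm p : Parab) : ℝ × ℝ) = (p.1, max p.2 (p.1 ^ 2)) := rfl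
/-- Auxiliary (modelHalf symm apply coe), see the module docstring. [folklore] -/
@[simp] theorem modelHalf_symm_apply_coe (p : ℝ × ℝ) :
    ((modelHalf.symm p : Half) : ℝ × ℝ) = (p.1, max p.2 0) := rfl

/-- Auxiliary (range modelParab), see the module docstring. [folklore] -/
theorem range_modelParab : range modelParab = parabolaRegion := Subtype.range_coe
/-- Auxiliary (range modelHalf), see the module docstring. [folklore] -/
theorem range_modelHalf : range modelHalf = upperHalfPlane := Subtype.range_coe

/-- The shear `(x, y) ↦ (x, y - x²)`, a polynomial diffeomorphism of `ℝ²` mapping the parabola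
region onto the half-plane. [folklore] -/
def shear : ℝ × ℝ → ℝ × ℝ := fun p => (p.1, p.2 - p.1 ^ 2)

/-- The inverse shear `(x, y) ↦ (x, y + x²)`. [folklore] -/
def unshear : ℝ × ℝ → ℝ × ℝ := fun p => (p.1, p.2 + p.1 ^ 2)

/-- Auxiliary (contDiff shear), see the module docstring. [folklore] -/
theorem contDiff_shear : ContDiff ℝ ∞ shear := by unfold shear; fun_prop
/-- Auxiliary (contDiff unshear), see the module docstring. [folklore] -/
theorem contDiff_unshear : ContDiff ℝ ∞ unshear := by unfold unshear; fun_prop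

/-- The shear as a diffeomorphism `Parab ≃ₘ⟮modelParab, modelHalf⟯ Half` (single charts; in
charts it is the polynomial map `shear`). [folklore] -/
def shearDiffeo : Parab ≃ₘ⟮modelParab, modelHalf⟯ Half where
  toFun p := ⟨shear p.1, by
    have h := p.2
    simp only [parabolaRegion, mem_setOf_eq] at h
    show 0 ≤ p.1.2 - p.1.1 ^ 2
    linarith⟩
  invFun q := ⟨unshear q.1, by
    have h := q.2
    simp only [upperHalfPlane, mem_setOf_eq] at h
    show q.1.1 ^ 2 ≤ q.1.2 + q.1.1 ^ 2
    linarith⟩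
  left_inv p := by ext <;> simp [shear, unshear]
  right_inv q := by ext <;> simp [shear, unshear]
  contMDiff_toFun := by
    have h1 : ContMDiffOn 𝓘(ℝ, ℝ × ℝ) modelHalf ∞ modelHalf.symm (range modelHalf) :=
      modelHalf.contMDiffOn_symm
    have h2 : ContMDiff modelParab 𝓘(ℝ, ℝ × ℝ) ∞ (shear ∘ modelParab) :=
      (contMDiff_iff_contDiff.2 contDiff_shear).comp modelParab.contMDiff
    have h3 := h1.comp_contMDiff h2 (fun p => by
      rw [range_modelHalf]
      have := p.2; simp only [parabolaRegion, mem_setOf_eq] at this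
      simp [upperHalfPlane, shear, this])
    refine h3.congr (fun p => ?_)
    have := p.2; simp only [parabolaRegion, mem_setOf_eq] at this
    ext <;> simp [shear, this]
  contMDiff_invFun := by
    have h1 : ContMDiffOn 𝓘(ℝ, ℝ × ℝ) modelParab ∞ modelParab.symm (range modelParab) :=
      modelParab.contMDiffOn_symm
    have h2 : ContMDiff modelHalf 𝓘(ℝ, ℝ × ℝ) ∞ (unshear ∘ modelHalf) :=
      (contMDiff_iff_contDiff.2 contDiff_unshear).comp modelHalf.contMDiff
    have h3 := h1.comp_contMDiff h2 (fun p => by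
      rw [range_modelParab]
      have := p.2; simp only [upperHalfPlane, mem_setOf_eq] at this
      simp [parabolaRegion, unshear, this])
    refine h3.congr (fun p => ?_)
    have := p.2; simp only [upperHalfPlane, mem_setOf_eq] at this
    ext <;> simp [unshear, this]

/-- `Parab` is the open gluing of `Parab` and `Parab` along equality (both pieces embedded by the
identity). [folklore] -/
theorem isOpenGluing_parab_eq :
    IsOpenGluing modelParab modelParab modelParab (A := Parab) (B := Parab) (P := Parab) Eq := by
  refine ⟨id, id, Manifold.IsSmoothEmbedding.id, by simp, Manifold.IsSmoothEmbedding.id, by simp,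
    by simp, fun a b => Iff.rfl⟩

section Refutation

variable {F : Type*} [NormedAddCommGroup F] [NormedSpace ℝ F] {j : Parab → Half}

/-- The corner point `(0, 0)` of the parabola region. [folklore] -/
def origin : Parab := ⟨(0, 0), by simp [parabolaRegion]⟩

/-- Auxiliary (origin coe), see the module docstring. [folklore] -/
@[simp] theorem origin_coe : ((origin : Parab) : ℝ × ℝ) = (0, 0) := rfl

/-- Auxiliary (modelParab symm zero), see the module docstring. [folklore] -/
@[simp] theorem modelParab_symm_zero : modelParab.symm (0, 0) = origin := by
  ext <;> simp

variable (h : Manifold.IsImmersionAtOfComplement F modelParab modelHalf ∞ j origin)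

/-- The linear map `u ↦ h.equiv (u, 0)` in which the immersion is written in the charts of `h`.
[folklore] -/
def linPart : (ℝ × ℝ) →L[ℝ] (ℝ × ℝ) :=
  (h.equiv : ((ℝ × ℝ) × F) →L[ℝ] (ℝ × ℝ)).comp (ContinuousLinearMap.inl ℝ (ℝ × ℝ) F)

/-- Auxiliary (linPart apply), see the module docstring. [folklore] -/
theorem linPart_apply (u : ℝ × ℝ) : linPart h u = h.equiv (u, 0) := rfl

/-- Auxiliary (mem target iff), see the module docstring. [folklore] -/
theorem mem_target_iff {u : ℝ × ℝ} :
    u ∈ (h.domChart.extend modelParab).target ↔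
      modelParab.symm u ∈ h.domChart.target ∧ u ∈ parabolaRegion := by
  rw [OpenPartialHomeomorph.extend_target, range_modelParab]
  rfl

/-- On the target `V` of the extended domain chart, `linPart h` is the map `j` read in charts; in
particular it takes values in the half-plane. [folklore] -/
theorem linPart_eq {u : ℝ × ℝ} (hu : u ∈ (h.domChart.extend modelParab).target) :
    linPart h u = ((h.codChart (j ((h.domChart.extend modelParab).symm u)) : Half) : ℝ × ℝ) := by
  have := h.writtenInCharts hu
  simp only [comp_apply, OpenPartialHomeomorph.extend_coe, modelHalf_apply] at this
  rw [linPart_apply, ← this]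

/-- Auxiliary (snd linPart nonneg), see the module docstring. [folklore] -/
theorem snd_linPart_nonneg {u : ℝ × ℝ} (hu : u ∈ (h.domChart.extend modelParab).target) :
    0 ≤ (linPart h u).2 := by
  rw [linPart_eq h hu]
  exact (Subtype.prop _ : _ ∈ upperHalfPlane)

/-- Auxiliary (linPart extend), see the module docstring. [folklore] -/
theorem linPart_extend {x : Parab} (hx : x ∈ h.domChart.source) :
    linPart h (h.domChart.extend modelParab x) = ((h.codChart (j x) : Half) : ℝ × ℝ) := by
  rw [linPart_eq h ((h.domChart.extend modelParab).map_source
    (by rwa [OpenPartialHomeomorph.extend_source])),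
    OpenPartialHomeomorph.extend_left_inv _ hx]

/-- Auxiliary (extend mem target), see the module docstring. [folklore] -/
theorem extend_mem_target {x : Parab} (hx : x ∈ h.domChart.source) :
    h.domChart.extend modelParab x ∈ (h.domChart.extend modelParab).target :=
  (h.domChart.extend modelParab).map_source (by rwa [OpenPartialHomeomorph.extend_source])

/-- Key openness step: around the image of a point of the domain chart, every point of the
half-plane close enough is a value of `linPart h` on `V` (because `j` is open and `h.codChart` is a
chart). [folklore] -/
theorem exists_ball_subset (hj : Topology.IsOpenEmbedding j) {x : Parab}
    (hx : x ∈ h.domChart.source) :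
    ∃ ε > 0, ∀ p : ℝ × ℝ, dist p ((h.codChart (j x) : Half) : ℝ × ℝ) < ε → 0 ≤ p.2 →
      p ∈ linPart h '' (h.domChart.extend modelParab).target := by
  set S : Set Half := h.codChart '' (j '' h.domChart.source) with hS
  have hSo : IsOpen S := h.codChart.isOpen_image_of_subset_source
    (hj.isOpenMap _ h.domChart.open_source) (image_subset_iff.2 h.source_subset_preimage_source)
  have hq : h.codChart (j x) ∈ S := ⟨j x, ⟨x, hx, rfl⟩, rfl⟩
  obtain ⟨ε, hε, hball⟩ := Metric.isOpen_iff.1 hSo _ hq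
  refine ⟨ε, hε, fun p hp hp2 => ?_⟩
  have hp' : (⟨p, hp2⟩ : Half) ∈ S := hball (by rw [Metric.mem_ball, Subtype.dist_eq]; exact hp)
  obtain ⟨_, ⟨x', hx', rfl⟩, hx'p⟩ := hp'
  refine ⟨h.domChart.extend modelParab x', extend_mem_target h hx', ?_⟩
  rw [linPart_extend h hx', hx'p]

/-- Step 1: the linear part is surjective (its range contains a ball of the open half-plane).
[folklore] -/
theorem linPart_surjective (hj : Topology.IsOpenEmbedding j) : Surjective (linPart h) := by
  obtain ⟨ε, hε, hball⟩ := exists_ball_subset h hj h.mem_domChart_source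
  set q : ℝ × ℝ := ((h.codChart (j origin) : Half) : ℝ × ℝ) with hq
  have hq2 : 0 ≤ q.2 := (Subtype.prop _ : _ ∈ upperHalfPlane)
  set c : ℝ × ℝ := q + (0, ε / 2) with hc
  have hsub : Metric.ball c (ε / 2) ⊆ range (linPart h) := by
    intro p hp
    rw [Metric.mem_ball, dist_eq_norm] at hp
    have h1 : |p.1 - q.1| < ε / 2 := by
      have := norm_fst_le (p - c); simp only [Prod.fst_sub, Real.norm_eq_abs] at this
      have hc1 : c.1 = q.1 := by simp [hc]
      rw [← hc1]; exact lt_of_le_of_lt this hp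
    have h2 : |p.2 - (q.2 + ε / 2)| < ε / 2 := by
      have := norm_snd_le (p - c); simp only [Prod.snd_sub, Real.norm_eq_abs] at this
      have hc2 : c.2 = q.2 + ε / 2 := by simp [hc]
      rw [← hc2]; exact lt_of_le_of_lt this hp
    have hd : dist p q < ε := by
      rw [dist_eq_norm, Prod.norm_def, Real.norm_eq_abs, Real.norm_eq_abs, max_lt_iff,
        Prod.fst_sub, Prod.snd_sub]
      refine ⟨by rw [abs_lt] at h1 ⊢; constructor <;> linarith, ?_⟩
      rw [abs_lt] at h2 ⊢; constructor <;> linarith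
    have hp2 : 0 ≤ p.2 := by rw [abs_lt] at h2; linarith
    obtain ⟨u, -, hu⟩ := hball p hd hp2
    exact ⟨u, hu⟩
  have htop : LinearMap.range (linPart h : (ℝ × ℝ) →ₗ[ℝ] (ℝ × ℝ)) = ⊤ := by
    apply Submodule.eq_top_of_nonempty_interior'
    refine ⟨c, mem_interior_iff_mem_nhds.2 (Filter.mem_of_superset (Metric.ball_mem_nhds c
      (half_pos hε)) ?_)⟩
    intro p hp
    exact hsub hp
  exact LinearMap.range_eq_top.1 htop

/-- Auxiliary (linPart injective), see the module docstring. [folklore] -/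
theorem linPart_injective (hj : Topology.IsOpenEmbedding j) : Injective (linPart h) :=
  LinearMap.injective_iff_surjective.2 (linPart_surjective h hj)

/-- The target `V` of the extended domain chart is a neighbourhood (in `ℝ²`) of each of its points
lying strictly above the parabola. [folklore] -/
theorem target_mem_nhds {u : ℝ × ℝ} (hu : u ∈ (h.domChart.extend modelParab).target)
    (hu' : u.1 ^ 2 < u.2) : (h.domChart.extend modelParab).target ∈ 𝓝 u := by
  rw [OpenPartialHomeomorph.extend_target, range_modelParab]
  rw [mem_target_iff] at hu
  refine Filter.inter_mem ?_ ?_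
  · exact (modelParab.continuous_symm.isOpen_preimage _ h.domChart.open_target).mem_nhds hu.1
  · exact Filter.mem_of_superset (isOpen_strictParabolaRegion.mem_nhds hu')
      (fun p (hp : p.1 ^ 2 < p.2) => (le_of_lt hp : p.1 ^ 2 ≤ p.2))

/-- Step 2: the corner `(0, 0)` is sent by the extended domain chart to a point of the parabola
`y = x²` (not strictly above it): otherwise the inverse extended chart would be a differentiable
map on a neighbourhood, with values in the region `y ≥ x² ≥ 0` and value `(0, 0)` at that point,
so its second component has a minimum there and its derivative is not injective, contradicting
the existence of the (within-)differentiable left inverse given by the chart. [folklore] -/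
theorem extend_origin_mem_parabola :
    (h.domChart.extend modelParab origin).1 ^ 2 = (h.domChart.extend modelParab origin).2 := by
  set φ := h.domChart.extend modelParab with hφ
  set v₀ := φ origin with hv₀
  have hv₀V : v₀ ∈ φ.target := extend_mem_target h h.mem_domChart_source
  have hle : v₀.1 ^ 2 ≤ v₀.2 := ((mem_target_iff h).1 hv₀V).2
  by_contra hne
  have hlt : v₀.1 ^ 2 < v₀.2 := lt_of_le_of_ne hle hne
  have hVn : φ.target ∈ 𝓝 v₀ := target_mem_nhds h hv₀V hlt
  -- the inverse extended chart, as a map `ℝ² → ℝ²`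
  set G : ℝ × ℝ → ℝ × ℝ := modelParab ∘ φ.symm with hG
  have hGs : ContMDiffOn 𝓘(ℝ, ℝ × ℝ) 𝓘(ℝ, ℝ × ℝ) ∞ G φ.target := by
    have h1 := contMDiffOn_extend_symm h.domChart_mem_maximalAtlas (I := modelParab)
    rw [← OpenPartialHomeomorph.extend_target'] at h1
    exact modelParab.contMDiff.comp_contMDiffOn h1
  rw [contMDiffOn_iff_contDiffOn] at hGs
  have hGd : HasFDerivAt G (fderiv ℝ G v₀) v₀ :=
    (((hGs v₀ hv₀V).contDiffAt hVn).differentiableAt (by simp)).hasFDerivAt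
  set D := fderiv ℝ G v₀ with hD
  have hGv₀ : G v₀ = (0, 0) := by
    simp only [hG, comp_apply, hv₀]
    rw [OpenPartialHomeomorph.extend_left_inv _ h.mem_domChart_source]
    rfl
  -- the second component of `G` has a minimum at `v₀`
  have hmin : IsLocalMin (fun u => (G u).2) v₀ := by
    refine Filter.Eventually.of_forall (fun u => ?_)
    show (G v₀).2 ≤ (G u).2
    rw [hGv₀]
    have : (G u).1 ^ 2 ≤ (G u).2 := (φ.symm u : Parab).2
    nlinarith
  have hD2 : (ContinuousLinearMap.snd ℝ ℝ ℝ).comp D = 0 := hmin.hasFDerivAt_eq_zero hGd.snd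
  -- the chart is a left inverse of `G`, differentiable within the region
  set Φ : ℝ × ℝ → ℝ × ℝ := φ ∘ modelParab.symm with hΦ
  set T : Set (ℝ × ℝ) := range modelParab ∩ modelParab.symm ⁻¹' h.domChart.source with hT
  have hΦs : ContMDiffOn 𝓘(ℝ, ℝ × ℝ) 𝓘(ℝ, ℝ × ℝ) ∞ Φ T :=
    (OpenPartialHomeomorph.contMDiffOn_extend h.domChart_mem_maximalAtlas).comp
      (modelParab.contMDiffOn_symm.mono inter_subset_left) (fun u hu => hu.2)
  rw [contMDiffOn_iff_contDiffOn] at hΦs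
  have h0T : G v₀ ∈ T := by
    rw [hGv₀]
    refine ⟨by rw [range_modelParab]; simp [parabolaRegion], ?_⟩
    show modelParab.symm (0, 0) ∈ h.domChart.source
    rw [modelParab_symm_zero]; exact h.mem_domChart_source
  have hΦd : HasFDerivWithinAt Φ (fderivWithin ℝ Φ T (G v₀)) T (G v₀) :=
    ((hΦs _ h0T).differentiableWithinAt (by simp)).hasFDerivWithinAt
  have hmaps : MapsTo G φ.target T := by
    intro u hu
    refine ⟨mem_range_self _, ?_⟩
    show modelParab.symm (modelParab (φ.symm u)) ∈ h.domChart.source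
    rw [modelParab.left_inv]
    have := φ.map_target hu
    rwa [OpenPartialHomeomorph.extend_source] at this
  have hcomp : HasFDerivAt (Φ ∘ G) ((fderivWithin ℝ Φ T (G v₀)).comp D) v₀ :=
    (hΦd.comp v₀ hGd.hasFDerivWithinAt hmaps).hasFDerivAt hVn
  have hid : HasFDerivAt (id : ℝ × ℝ → ℝ × ℝ) ((fderivWithin ℝ Φ T (G v₀)).comp D) v₀ := by
    refine hcomp.congr_of_eventuallyEq ?_
    filter_upwards [hVn] with u hu
    simp only [id_eq, hΦ, hG, comp_apply]
    rw [modelParab.left_inv]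
    exact (φ.right_inv hu).symm
  have hcompid : (fderivWithin ℝ Φ T (G v₀)).comp D = ContinuousLinearMap.id ℝ (ℝ × ℝ) :=
    hid.unique (hasFDerivAt_id v₀) |>.symm ▸ rfl
  -- hence `D` is injective, hence surjective, contradicting `snd ∘ D = 0`
  have hDinj : Injective D := by
    intro x y hxy
    have := congrArg (fderivWithin ℝ Φ T (G v₀)) hxy
    have hx := congrArg (fun f : (ℝ × ℝ) →L[ℝ] (ℝ × ℝ) => f x) hcompid
    have hy := congrArg (fun f : (ℝ × ℝ) →L[ℝ] (ℝ × ℝ) => f y) hcompid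
    simp only [ContinuousLinearMap.coe_comp, comp_apply, ContinuousLinearMap.coe_id',
      id_eq] at hx hy
    rw [← hx, ← hy, this]
  have hDsurj : Surjective (D : (ℝ × ℝ) →ₗ[ℝ] (ℝ × ℝ)) :=
    LinearMap.injective_iff_surjective.1 hDinj
  obtain ⟨x, hx⟩ := hDsurj (0, 1)
  have := congrArg (fun f : (ℝ × ℝ) →L[ℝ] ℝ => f x) hD2
  simp only [ContinuousLinearMap.coe_comp, comp_apply, ContinuousLinearMap.coe_snd',
    zero_apply] at this
  rw [show (D x) = (0, 1) from hx] at this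
  norm_num at this

/-- Step 3a: at every point `(x, x²)` of the parabola lying in the target `V` of the extended
domain chart, the linear part has vanishing second component: otherwise its value would be an
interior point of the half-plane, a whole ball around it would consist of values of `linPart h`
on `V` (Step "openness"), and by injectivity the points `(x, x² - t)`, `t > 0` small, would lie
in `V ⊆ {y ≥ x²}`. [folklore] -/
theorem snd_linPart_parabola_eq_zero (hj : Topology.IsOpenEmbedding j) {x : ℝ}
    (hx : ((x, x ^ 2) : ℝ × ℝ) ∈ (h.domChart.extend modelParab).target) :
    (linPart h (x, x ^ 2)).2 = 0 := by
  set φ := h.domChart.extend modelParab with hφ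
  rcases (snd_linPart_nonneg h hx).eq_or_lt with heq | hpos
  · exact heq.symm
  exfalso
  set y : Parab := φ.symm (x, x ^ 2) with hy
  have hyU : y ∈ h.domChart.source := by
    have := φ.map_target hx
    rwa [OpenPartialHomeomorph.extend_source] at this
  obtain ⟨ε, hε, hball⟩ := exists_ball_subset h hj hyU
  have hq : ((h.codChart (j y) : Half) : ℝ × ℝ) = linPart h (x, x ^ 2) := (linPart_eq h hx).symm
  rw [hq] at hball
  -- points just below the parabola are mapped close to `linPart h (x, x²)`
  have htend : Filter.Tendsto (fun t : ℝ => linPart h (x, x ^ 2 - t)) (𝓝[>] 0)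
      (𝓝 (linPart h (x, x ^ 2))) := by
    have : Continuous (fun t : ℝ => linPart h (x, x ^ 2 - t)) := by fun_prop
    have h0 := this.tendsto 0
    simp only [sub_zero] at h0
    exact h0.mono_left nhdsWithin_le_nhds
  have hnhds : {p : ℝ × ℝ | dist p (linPart h (x, x ^ 2)) < ε ∧ 0 < p.2} ∈
      𝓝 (linPart h (x, x ^ 2)) := by
    refine Filter.inter_mem (Metric.ball_mem_nhds _ hε) ?_
    exact isOpen_strictUpperHalfPlane.mem_nhds hpos
  have hev := (htend.eventually hnhds).and (self_mem_nhdsWithin : Ioi (0 : ℝ) ∈ 𝓝[>] (0 : ℝ))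
  obtain ⟨t, ⟨ht1, ht2⟩, ht⟩ := hev.exists
  obtain ⟨u, hu, hut⟩ := hball _ ht1 ht2.le
  have huq : u = (x, x ^ 2 - t) := linPart_injective h hj hut
  rw [huq] at hu
  have : x ^ 2 ≤ x ^ 2 - t := ((mem_target_iff h).1 hu).2
  have ht' : (0 : ℝ) < t := ht
  linarith

include h in
/-- Step 3b: contradiction. The corner is charted onto a parabola point `(s, s²)`; nearby
parabola points lie in the target `V`; the quadratic polynomial `x ↦ (linPart h (x, x²)).2`
vanishes near `s`, so the linear functional `snd ∘ linPart h` vanishes, contradicting the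
surjectivity of `linPart h`. [folklore] -/
theorem false_of_isImmersionAt (hj : Topology.IsOpenEmbedding j) : False := by
  set φ := h.domChart.extend modelParab with hφ
  set v₀ := φ origin with hv₀
  have hv₀V : v₀ ∈ φ.target := extend_mem_target h h.mem_domChart_source
  have hpar : v₀.1 ^ 2 = v₀.2 := extend_origin_mem_parabola h
  set s := v₀.1 with hs
  have hv₀eq : v₀ = (s, s ^ 2) := Prod.ext rfl hpar.symm
  -- parabola points near `v₀` lie in the target
  have hO : IsOpen (modelParab.symm ⁻¹' h.domChart.target) :=
    modelParab.continuous_symm.isOpen_preimage _ h.domChart.open_target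
  have hγ : Continuous (fun x : ℝ => ((x, x ^ 2) : ℝ × ℝ)) := by fun_prop
  have hev : ∀ᶠ x in 𝓝 s, ((x, x ^ 2) : ℝ × ℝ) ∈ φ.target := by
    have h1 : ((s, s ^ 2) : ℝ × ℝ) ∈ modelParab.symm ⁻¹' h.domChart.target := by
      rw [← hv₀eq]; exact ((mem_target_iff h).1 hv₀V).1
    filter_upwards [hγ.continuousAt.preimage_mem_nhds (hO.mem_nhds h1)] with x hx
    exact (mem_target_iff h).2 ⟨hx, (le_refl _ : x ^ 2 ≤ x ^ 2)⟩
  -- the quadratic polynomial `α x + β x²` vanishes near `s`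
  set α := (linPart h (1, 0)).2 with hα
  set β := (linPart h (0, 1)).2 with hβ
  have hlin : ∀ u : ℝ × ℝ, (linPart h u).2 = α * u.1 + β * u.2 := by
    intro u
    have : u = u.1 • ((1, 0) : ℝ × ℝ) + u.2 • ((0, 1) : ℝ × ℝ) := by ext <;> simp
    conv_lhs => rw [this]
    simp only [map_add, map_smul, Prod.snd_add, Prod.smul_snd, smul_eq_mul, hα, hβ]
    ring
  have hpoly : ∀ᶠ x in 𝓝 s, α * x + β * x ^ 2 = 0 := by
    filter_upwards [hev] with x hx
    have := hlin (x, x ^ 2)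
    rw [snd_linPart_parabola_eq_zero h hj hx] at this
    exact this.symm
  obtain ⟨δ, hδ, hδball⟩ := Metric.eventually_nhds_iff.1 hpoly
  have e0 := hδball (y := s) (by simpa using hδ)
  have e1 := hδball (y := s + δ / 2) (by
    rw [Real.dist_eq, show s + δ / 2 - s = δ / 2 by ring, abs_of_pos (half_pos hδ)]
    exact half_lt_self hδ)
  have e2 := hδball (y := s - δ / 2) (by
    rw [Real.dist_eq, show s - δ / 2 - s = -(δ / 2) by ring, abs_neg, abs_of_pos (half_pos hδ)]
    exact half_lt_self hδ)
  have hβ0 : β = 0 := by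
    have : β * (δ / 2) ^ 2 * 2 = 0 := by linear_combination e1 + e2 - 2 * e0
    have hδ2 : (δ / 2) ^ 2 * 2 ≠ 0 := by positivity
    have : β * ((δ / 2) ^ 2 * 2) = 0 := by rw [← mul_assoc]; exact this
    exact (mul_eq_zero.1 this).resolve_right hδ2
  have hα0 : α = 0 := by
    have : α * (δ / 2) = 0 := by linear_combination e1 - e0 - (2 * s * (δ / 2) + (δ/2)^2) * hβ0
    exact (mul_eq_zero.1 this).resolve_right (ne_of_gt (half_pos hδ))
  -- contradiction with surjectivity
  obtain ⟨u, hu⟩ := linPart_surjective h hj (0, 1)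
  have := hlin u
  rw [hu, hα0, hβ0] at this
  norm_num at this

end Refutation

/-- **There is no open smooth embedding of the parabola region onto the half-plane** for the
inclusion models `modelParab`, `modelHalf`: a surjective `C^∞` embedding
`Parab → Half` cannot be an immersion at the corner `(0, 0)`. [folklore] -/
theorem not_isSmoothEmbedding_of_surjective {j : Parab → Half}
    (hj : Manifold.IsSmoothEmbedding modelParab modelHalf ∞ j) (hs : Surjective j) : False := by
  obtain ⟨F, _, _, h⟩ := hj.isImmersion.isImmersionAt origin
  exact false_of_isImmersionAt h ⟨hj.isEmbedding, by rw [hs.range_eq]; exact isOpen_univ⟩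

/-- The half-plane `Half` (model `modelHalf`) is **not** an open gluing of `Parab` and `Parab`
along equality (models `modelParab`), although the diffeomorphic `Parab` (model `modelParab`) is
(`isOpenGluing_parab_eq`, `shearDiffeo`). [folklore] -/
theorem not_isOpenGluing_half :
    ¬ IsOpenGluing modelParab modelParab modelHalf (A := Parab) (B := Parab) (P := Half) Eq := by
  rintro ⟨jA, jB, hA, -, -, -, hU, hR⟩
  have hAB : jA = jB := funext fun a => (hR a a).2 rfl
  have hs : Surjective jA := by
    intro q
    have : q ∈ range jA ∪ range jB := hU ▸ mem_univ q
    rw [← hAB, union_self] at this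
    exact this
  exact not_isSmoothEmbedding_of_surjective hA hs

/-- **The named fact `Literature.Topology.FourManifolds.IsOpenGluing.of_diffeomorph` is false**: its instance with
`IA = IB = IP = modelParab`, `IP' = modelHalf`, `A = B = P = Parab`, `P' = Half` fails, by
`isOpenGluing_parab_eq`, the diffeomorphism `shearDiffeo : Parab ≃ₘ⟮modelParab, modelHalf⟯ Half`
and `not_isOpenGluing_half`. [folklore] -/
theorem not_isOpenGluing_of_diffeomorph :
    ¬ IsOpenGluing.of_diffeomorph (IA := modelParab) (IB := modelParab) (IP := modelParab)
      (IP' := modelHalf) (A := Parab) (B := Parab) (P := Parab) (P' := Half) :=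
  fun H => not_isOpenGluing_half (H isOpenGluing_parab_eq shearDiffeo)

end OpenGluingCounterexample

end Literature.Topology.FourManifolds
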